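import Summits.QuantumFields.YangMills.Theorems.IR.AfPincerUcTypChainDeep
import Summits.QuantumFields.YangMills.Theorems.IR.AfPincerUcTypChainReduced
import HarnessLib

/-!
# Crux `IR` (stmt-QuantumFields-19354), line `af-pincer-Uc`: the DEEP short-chain class `TypChainDeep` (2/2) — clause (iii) INHERITED,
# clause (ii) REDUCED BY NAME to deep kernel sparseness, and the lane-A supplier targets of the deep class composed to I♯_SC and `IR`
# by name (seat ym-19354-afpincer-s1 g3)

Helper module for item `stmt-QuantumFields-19354` (`--supports stmt-QuantumFields-19354 --as helper`; it closes nothing; registry and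
slot of record «sharp merge I♯_SC» `Cruxes/IR/Lines/af_pincer_Uc_sharp.lean` sha16 `28967a1bf60ad397` UNTOUCHED; open stub
`stub_onsetSharpSC : AfPincerUc.SharpOnset.OnsetSharpUKPcSC`).  Part 1/2 (`AfPincerUcTypChainDeep`) typed the LEAD's located re-cut
candidate «TypChainDeep» (closing line 18:11Z, (B)(5)) — the short-chain class read on the depth-`D` core `deepPlaqs w D c` of each cell —
with its `TypLocal` and insertion-tolerance bookkeeping.  This part does for the deep class exactly what S1 g2 / the LEAD did for
`TypChain` (p540903, p542014, p539933, p544202), by name and with the same constants: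

* §1 clause (iii) for `TypChainDeep` INHERITED from `clauseIII_typChain` (`clauseIII_typChainDeep`, `exists_extent_clauseIII_typChainDeep`:
  same budget `3750 q ≤ 1/2`, `192 b⁴ q (3750 q)^{⌈ℓ₀/2⌉} ≤ δ` at `q = e^{−θβ/12}`, same extent `2⌈48 C⁺/θ⌉₊`, every depth `D`;
  `clauseIII_of_subset` + `typChain_subset_typChainDeep`); and the PRICE TAG on the clause-(i) side, `clauseIAll_typChain_of_typChainDeep`:
  (i) for the deep class implies (i) for `TypChain` (clause (i) is antitone in the class) — the re-cut moves weight from (ii) to (i).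
* §2 **`KernelPlaqSparseDeep ρ β w θ ℓ₀ D q`** — the (ii)-side content of the deep class NAMED: kernel sparseness of `θ`-bad plaquette
  SETS asked ONLY of sets inside the depth-`D` cores of the charged cells, uniformly over exteriors meeting the format's guard FOR THE DEEP
  CLASS; `clauseIIukp_typChainDeep_of_kernelPlaqSparseDeep` — clause (ii) (UKP) for `TypChainDeep` from it, via S1 g2's abstract hereditary
  Peierls bound `measure_forall_hasBadChainAmong_le_pow` with cells `deepPlaqs w D c` (pairwise disjoint, `≤ 96 b⁴` plaquettes), `Φ = id`.
* §3 the supplier targets of the deep class and their compositions BY NAME: `TypChainDeepSharpSC` (format instantiation: (i), (ii), (iii)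
  for `TypChainDeep r.ρ θ w ℓ₀ D`, supplier's `(n, ε, θ, ℓ₀, D)`) ⇒ I♯_SC (`onsetSharpUKPcSC_of_typChainDeepSharpSC`, `typLocal_typChainDeep`)
  ⇒ with the residual `IR` (`ir_of_typChainDeepSharpSC`); the press-button `typChainDeepSharpSC_of_clauses_expMesh` ((i)+(ii) at
  exponential meshes, (iii) from §1); the REDUCED target **`TypChainDeepReducedAtSC`** = clause (i) for `TypChainDeep r.ρ θ w (extentOf θ κ C) D`
  + `KernelPlaqSparseDeep … (extentOf θ κ C) D e^{−κβ}` at meshes `b ≤ B e^{Cβ}` (the LEAD's `extentOf`/`budget_of_extent` reused verbatim),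
  `clauses_typChainDeep_extentOf`, `typChainDeepSharpSC_of_reducedAt`, `onsetSharpUKPcSC_of_typChainDeepReducedAtSC`,
  **`ir_of_typChainDeepReducedAtSC : TypChainDeepReducedAtSC → SharpOnset.IRNSC → Theses.BalabanLadder.IR`**.

WHAT THE KERNEL SAYS AFTER THIS FILE (if the owner adopts the re-cut; nothing of record changes by this file): `stub_onsetSharpSC` ⇐
`TypChainDeepReducedAtSC` = clause (i) `ClauseIAll … (TypChainDeep r.ρ θ w ℓ₀ D)` at a mesh `≍ min(1/a, e^{Cβ})` (weak-coupling mixing for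
collars typical IN THE DEEP SENSE — their boundary layers unconstrained; the crux content, unchanged in kind) AND `KernelPlaqSparseDeep`
(uniform-in-exterior rarity of `θ`-bad sets in the depth-`D` CORE under the DLR kernels — research-grade as before, but no longer asked in
the boundary layer where both cooling probes locate every measured forcing).  `KernelPlaqSparseDeep` vs `KernelPlaqSparse`: fewer charged
sets, larger guard — not comparable by implication.

HONEST FRAMING: by-name bookkeeping around ONE open stub of a CONDITIONAL chain (Track A 0/28 UV); none of the named hypotheses is
asserted; nothing of weak-coupling mixing, asymptotic freedom or a gap is proved or claimed; not infinite volume, not Clay.  No `sorry`;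
axioms ⊆ {propext, Classical.choice, Quot.sound}; no instances, no notation.
-/

set_option autoImplicit false

noncomputable section

open Filter Topology MeasureTheory
open Literature.MathematicalPhysics.QuantumFieldTheory hiding ZdEdge
open Literature.MathematicalPhysics.QuantumLattice
open Summit.QuantumFields.YangMills.Cruxes.OSLegsFromFemtoAndGap.DlrCollarTransfer (LowerBounds)
open Summit.QuantumFields.YangMills.Cruxes.IR.Tempered (regionEdges)
open Summit.QuantumFields.YangMills.Theorems.OddTorusChessboard (plaqAction)

namespace Summit.QuantumFields.YangMills.Cruxes.IR.AfPincerUc.SharpLanes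

open Summit.QuantumFields.YangMills.Cruxes.IR.AfPincerUc

/-! ## §1 Clause (iii) for the deep class — INHERITED from the torus anchor of `TypChain` -/
section Torus

variable {G : Type} [Group G] [TopologicalSpace G] [IsTopologicalGroup G] [CompactSpace G]
  [MeasurableSpace G] [BorelSpace G]

/-- **Clause (iii) — the torus anchor — for `TypChainDeep` (PROVED, inherited)**: same hypotheses and budget as `clauseIII_typChain`
(`3750 q ≤ 1/2`, `192 b⁴ q (3750 q)^{⌈ℓ₀/2⌉} ≤ δ` at `q = e^{−θβ/12}`), every depth `D`; the failure event of the larger class is smaller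
(`clauseIII_of_subset`, `typChain_subset_typChainDeep`). -/
theorem clauseIII_typChainDeep (r : LatticeRep G) {θ : ℝ} (hθ : 0 < θ) (D : ℕ) :
    ∃ β₁ : ℝ, ∀ β : ℝ, β₁ ≤ β → ∀ (b ℓ₀ : ℕ) (δ : ℝ), 1 ≤ b →
      3750 * Real.exp (-(θ / 12 * β)) ≤ 1 / 2 →
        192 * (b : ℝ) ^ 4 * Real.exp (-(θ / 12 * β)) * (3750 * Real.exp (-(θ / 12 * β))) ^ ((ℓ₀ + 1) / 2) ≤ δ →
          ∀ w : Fin 4 → ℤ → ℤ, IsFrame b w → ClauseIII r.ρ β w b δ (TypChainDeep r.ρ θ w ℓ₀ D) := by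
  obtain ⟨β₁, h⟩ := clauseIII_typChain (G := G) r hθ
  exact ⟨β₁, fun β hβ b ℓ₀ δ hb hhalf hbudget w hw =>
    clauseIII_of_subset (fun c => typChain_subset_typChainDeep θ w ℓ₀ D c) (h β hβ b ℓ₀ δ hb hhalf hbudget w hw)⟩

/-- **Clause (iii) for `TypChainDeep` in the supplier's quantifier order at exponential meshes (PROVED, inherited)**: for `θ > 0`, a
growth rate `C` and every depth `D` there is a FIXED extent `ℓ₀` (the `TypChain` one, `2⌈48 C⁺/θ⌉₊`) such that for every `δ > 0` and
prefactor `B` there is `β₂` with `ClauseIII r.ρ β w b δ (TypChainDeep r.ρ θ w ℓ₀ D)` for all `β ≥ β₂`, meshes `1 ≤ b ≤ B e^{Cβ}`, frames `w`. -/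
theorem exists_extent_clauseIII_typChainDeep (r : LatticeRep G) {θ : ℝ} (hθ : 0 < θ) (C : ℝ) (D : ℕ) :
    ∃ ℓ₀ : ℕ, ∀ δ : ℝ, 0 < δ → ∀ B : ℝ, ∃ β₂ : ℝ, ∀ β : ℝ, β₂ ≤ β → ∀ b : ℕ, 1 ≤ b →
      (b : ℝ) ≤ B * Real.exp (C * β) → ∀ w : Fin 4 → ℤ → ℤ, IsFrame b w →
        ClauseIII r.ρ β w b δ (TypChainDeep r.ρ θ w ℓ₀ D) := by
  obtain ⟨ℓ₀, h⟩ := exists_extent_clauseIII_typChain (G := G) r hθ C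
  refine ⟨ℓ₀, fun δ hδ B => ?_⟩
  obtain ⟨β₂, hβ₂⟩ := h δ hδ B
  exact ⟨β₂, fun β hβ b hb hbB w hw =>
    clauseIII_of_subset (fun c => typChain_subset_typChainDeep θ w ℓ₀ D c) (hβ₂ β hβ b hb hbB w hw)⟩

/-- **The price tag of the re-cut on the clause-(i) side (PROVED): clause (i) at every centre for `TypChainDeep` IMPLIES clause (i)
for the class of record `TypChain`** (clause (i) is antitone in the class — a larger typical class admits more exterior pairs to
control; `typChain_subset_typChainDeep`).  So the deep re-cut moves weight from (ii) (asked on the core only) to (i) (asked for collars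
typical in the weaker, deep sense); it never makes (i) easier. -/
theorem clauseIAll_typChain_of_typChainDeep {N : ℕ} {ρ : G →* Matrix (Fin N) (Fin N) ℂ} {β : ℝ} {w : Fin 4 → ℤ → ℤ}
    {n : ℕ} {ε θ : ℝ} {ℓ₀ D : ℕ} (hI : ClauseIAll ρ β w n ε (TypChainDeep ρ θ w ℓ₀ D)) :
    ClauseIAll ρ β w n ε (TypChain ρ θ w ℓ₀) :=
  fun c₀ Y hYw h0 σ σ' htyp hagree f hf hfm hf01 =>
    hI c₀ Y hYw h0 σ σ' (fun c hc hcY =>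
      ⟨typChain_subset_typChainDeep θ w ℓ₀ D (c + c₀) (htyp c hc hcY).1,
        typChain_subset_typChainDeep θ w ℓ₀ D (c + c₀) (htyp c hc hcY).2⟩) hagree f hf hfm hf01

end Torus

/-! ## §2 Clause (ii) (UKP) for the deep class, REDUCED BY NAME to DEEP kernel sparseness -/
section Kernel

variable {G : Type} [Group G] [TopologicalSpace G] [IsTopologicalGroup G] [CompactSpace G]
  [MeasurableSpace G] [BorelSpace G]

/-- **DEEP kernel plaquette-set sparseness (the (ii)-side content of the deep class, NAMED; NOT proved anywhere).**  At coupling `β`,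
frame `w`, threshold `θ`, extent `ℓ₀` and depth `D` (both entering only through the guard and the charged universe) and base `q`: for all
finite cell families `F ⊆ F'`, `F` nonempty, every exterior `ζ` meeting the format's guard FOR THE DEEP CLASS (each cell within
sup-distance `1` of a cell of `F` is resampled, `∈ F'`, or `ζ ∈ TypChainDeep ρ θ w ℓ₀ D c'` — its boundary layers unconstrained), and every
set `X` of DEEP plaquettes of the cells of `F` (`X ⊆ ⋃_{c ∈ F} deepPlaqs w D c`), the DLR kernel of the region `F'` gives
`γ_{F'}(ζ){σ | ∀ p ∈ X, θ ≤ plaqAction ρ p σ} ≤ q ^ #X`.  Compared with `KernelPlaqSparse` (p544202): FEWER charged sets (only the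
depth-`D` cores — where both cooling probes measure `≤ 0.03` of the exterior level), a LARGER guard (neighbours typical only in the deep
sense); the two are not comparable by implication. -/
def KernelPlaqSparseDeep {N : ℕ} (ρ : G →* Matrix (Fin N) (Fin N) ℂ) (β : ℝ) (w : Fin 4 → ℤ → ℤ) (θ : ℝ) (ℓ₀ D : ℕ)
    (q : ℝ) : Prop :=
  ∀ F F' : Finset (Fin 4 → ℤ), F ⊆ F' → F.Nonempty → ∀ ζ : LGConfig 4 G,
    (∀ c ∈ F, ∀ c' : Fin 4 → ℤ, (∀ i, |c' i - c i| ≤ 1) → c' ∈ F' ∨ ζ ∈ TypChainDeep ρ θ w ℓ₀ D c') →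
      ∀ X : Finset (ZdPlaquette 4), X ⊆ F.biUnion (deepPlaqs w D) →
        (ymSpecification ρ β (regionEdges w F') ζ) {σ : LGConfig 4 G | ∀ p ∈ X, θ ≤ plaqAction ρ p σ} ≤
          ENNReal.ofReal (q ^ X.card)

/-- `KernelPlaqSparseDeep` is antitone in the base: a smaller base is a stronger statement. -/
theorem KernelPlaqSparseDeep.mono {N : ℕ} {ρ : G →* Matrix (Fin N) (Fin N) ℂ} {β : ℝ} {w : Fin 4 → ℤ → ℤ} {θ : ℝ}
    {ℓ₀ D : ℕ} {q q' : ℝ} (hq0 : 0 ≤ q) (hqq' : q ≤ q') (h : KernelPlaqSparseDeep ρ β w θ ℓ₀ D q) :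
    KernelPlaqSparseDeep ρ β w θ ℓ₀ D q' :=
  fun F F' hFF' hF ζ hguard X hX =>
    (h F F' hFF' hF ζ hguard X hX).trans (ENNReal.ofReal_le_ofReal (pow_le_pow_left₀ hq0 hqq' _))

/-- **Clause (ii) in UKP form for `TypChainDeep`, from DEEP kernel sparseness (PROVED reduction; the hypothesis is the research content).**
With `3750 q ≤ 1/2` and the budget `192 b⁴ q (3750 q)^{⌈ℓ₀/2⌉} ≤ δ`, `KernelPlaqSparseDeep ρ β w θ ℓ₀ D q` gives
`ClauseIIukp ρ β w δ (TypChainDeep ρ θ w ℓ₀ D)` on the mesh-`b` frame `w` — S1 g2's hereditary Peierls bound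
`measure_forall_hasBadChainAmong_le_pow` with the DEEP cells `deepPlaqs w D c` (pairwise disjoint, `≤ 96 b⁴` plaquettes each), `Φ = id`. -/
theorem clauseIIukp_typChainDeep_of_kernelPlaqSparseDeep {N : ℕ} (ρ : G →* Matrix (Fin N) (Fin N) ℂ) (β : ℝ) {b : ℕ}
    {w : Fin 4 → ℤ → ℤ} (hw : IsFrame b w) {θ : ℝ} {ℓ₀ D : ℕ} {q δ : ℝ} (hq0 : 0 ≤ q) (hq : 3750 * q ≤ 1 / 2)
    (hδ : 192 * (b : ℝ) ^ 4 * q * (3750 * q) ^ ((ℓ₀ + 1) / 2) ≤ δ) (hK : KernelPlaqSparseDeep ρ β w θ ℓ₀ D q) :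
    ClauseIIukp ρ β w δ (TypChainDeep ρ θ w ℓ₀ D) := by
  classical
  intro F F' hFF' hF ζ hguard
  have hn : ∀ c ∈ F, (deepPlaqs w D c).card ≤ 96 * b ^ 4 := fun c _ => card_deepPlaqs_le hw D c
  have hmain := measure_forall_hasBadChainAmong_le_pow ρ (ymSpecification ρ β (regionEdges w F') ζ) id θ F
    (deepPlaqs w D) (F.biUnion (deepPlaqs w D)) (fun c hc => Finset.subset_biUnion_of_mem _ hc)
    (fun c _ c' _ hcc => disjoint_deepPlaqs hw D hcc) hn hq0 hq (fun X hX => hK F F' hFF' hF ζ hguard X hX) ℓ₀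
  have hev : {σ : LGConfig 4 G | ∀ c ∈ F, σ ∉ TypChainDeep ρ θ w ℓ₀ D c} =
      {σ | ∀ c ∈ F, HasBadChainAmong ρ θ (↑(deepPlaqs w D c)) ℓ₀ (id σ)} := by
    ext σ
    simp only [Set.mem_setOf_eq, TypChainDeep, not_not, id]
  rw [hev]
  refine hmain.trans (ENNReal.ofReal_le_ofReal (pow_le_pow_left₀ (by positivity) ?_ _))
  calc 2 * ((96 * b ^ 4 : ℕ) : ℝ) * q * (3750 * q) ^ ((ℓ₀ + 1) / 2)
      = 192 * (b : ℝ) ^ 4 * q * (3750 * q) ^ ((ℓ₀ + 1) / 2) := by push_cast; ring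
    _ ≤ δ := hδ

end Kernel

/-! ## §3 The lane-A supplier targets OF THE DEEP CLASS and their compositions to I♯_SC and `IR` by name -/
section Supplier

/-- **Lane-A supplier statement for the DEEP short-chain class (format instantiation; R107-compliant by
`insertionTolerant_typChainDeep_sharp`).**  For every simply connected compact simple `G`, `r`, positive unit `a → 0` with `LowerBounds G r a`:
admissible `(n, ε)`, a badness threshold `θ`, a tolerated extent `ℓ₀` AND A DEPTH `D`, and for every budget `δ > 0` a window `T` such that
for all large `β` SOME mesh `b ≥ 1` with `a β · b < T` carries, on every mesh-`b` frame, clause (i) at every centre, clause (ii) in UKP form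
and clause (iii) FOR `TypChainDeep r.ρ θ w ℓ₀ D`.  (`TypChainSharpSC` is the depth-`0` instance up to `typChainDeep_zero`.) -/
def TypChainDeepSharpSC : Prop :=
  ∀ (G : Type) [Group G] [TopologicalSpace G] [IsTopologicalGroup G] [CompactSpace G],
    IsCompactSimpleLieGroup G → SimplyConnectedSpace G →
    letI : MeasurableSpace G := borel G; haveI : BorelSpace G := ⟨rfl⟩;
    ∀ (r : LatticeRep G) (a : ℝ → ℝ), (∀ β, 0 < a β) → Tendsto a atTop (𝓝 0) → LowerBounds G r a →
      ∃ (n : ℕ) (ε : ℝ) (θ : ℝ) (ℓ₀ D : ℕ), 1 ≤ n ∧ 0 ≤ ε ∧ ε * OnsetFormats.shellCount n ≤ 3 / 4 ∧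
        ∀ δ : ℝ, 0 < δ → ∃ T β₂ : ℝ, ∀ β : ℝ, β₂ ≤ β → ∃ b : ℕ, 1 ≤ b ∧ a β * (b : ℝ) < T ∧
          ∀ w : Fin 4 → ℤ → ℤ, IsFrame b w →
            ClauseIAll r.ρ β w n ε (TypChainDeep r.ρ θ w ℓ₀ D) ∧ ClauseIIukp r.ρ β w δ (TypChainDeep r.ρ θ w ℓ₀ D) ∧
              ClauseIII r.ρ β w b δ (TypChainDeep r.ρ θ w ℓ₀ D)

/-- **`TypChainSharpSC ⇒ TypChainDeepSharpSC` (PROVED)**: the class of record is the depth-`0` deep class (`typChainDeep_zero`). -/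
theorem typChainDeepSharpSC_of_typChainSharpSC (h : TypChainSharpSC) : TypChainDeepSharpSC := by
  intro G _ _ _ _ hG hsc
  letI : MeasurableSpace G := borel G
  haveI : BorelSpace G := ⟨rfl⟩
  intro r a ha hat hlb
  obtain ⟨n, ε, θ, ℓ₀, hn, hε, hM, hrest⟩ := h G hG hsc r a ha hat hlb
  refine ⟨n, ε, θ, ℓ₀, 0, hn, hε, hM, fun δ hδ => ?_⟩
  obtain ⟨T, β₂, hβ⟩ := hrest δ hδ
  refine ⟨T, β₂, fun β hb => ?_⟩
  obtain ⟨b, hb1, hlt, hw⟩ := hβ β hb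
  refine ⟨b, hb1, hlt, fun w hwf => ?_⟩
  have e : TypChainDeep r.ρ θ w ℓ₀ 0 = TypChain r.ρ θ w ℓ₀ := funext fun c => typChainDeep_zero θ w ℓ₀ c
  rw [e]
  exact hw w hwf

/-- **`TypChainDeepSharpSC` ⇒ I♯_SC (PROVED)** — instantiate the format's `∃ Typ` at `TypChainDeep r.ρ θ w ℓ₀ D` (`typLocal_typChainDeep`). -/
theorem onsetSharpUKPcSC_of_typChainDeepSharpSC (h : TypChainDeepSharpSC) : SharpOnset.OnsetSharpUKPcSC := by
  intro G _ _ _ _ hG hsc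
  letI : MeasurableSpace G := borel G
  haveI : BorelSpace G := ⟨rfl⟩
  intro r a ha hat hlb
  haveI : T2Space G := T2Space.of_injective_continuous r.injective r.continuous
  haveI : SecondCountableTopology G :=
    (r.continuous.isClosedEmbedding r.injective).isEmbedding.secondCountableTopology
  obtain ⟨n, ε, θ, ℓ₀, D, hn, hε, hM, hrest⟩ := h G hG hsc r a ha hat hlb
  refine ⟨n, ε, hn, hε, hM, fun δ hδ => ?_⟩
  obtain ⟨T, β₂, hβ⟩ := hrest δ hδ
  refine ⟨T, β₂, fun β hb => ?_⟩
  obtain ⟨b, hb1, hlt, hw⟩ := hβ β hb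
  refine ⟨b, hb1, hlt, fun w hwf => ?_⟩
  obtain ⟨hI, hII, hIII⟩ := hw w hwf
  exact ⟨TypChainDeep r.ρ θ w ℓ₀ D, typLocal_typChainDeep r.ρ r.continuous θ w ℓ₀ D, hI, hII, hIII⟩

/-- **`TypChainDeepSharpSC` ∧ residual ⇒ `BalabanLadder.IR` BY NAME (PROVED, E discharged, no X).** -/
theorem ir_of_typChainDeepSharpSC (h : TypChainDeepSharpSC) (hN : SharpOnset.IRNSC) :
    Summit.QuantumFields.YangMills.Theses.BalabanLadder.IR :=
  SharpOnset.ir_of_onsetSharpSC (onsetSharpUKPcSC_of_typChainDeepSharpSC h) hN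

/-- **`TypChainDeepSharpSC` from its clauses (i) and (ii) alone, at exponential meshes (PROVED glue; (iii) = `exists_extent_clauseIII_typChainDeep`).**
As `typChainSharpSC_of_clauses_expMesh` for the class of record: the supplier names `(n, ε)`, `θ > 0`, a mesh growth `C` and a depth `D`
and delivers, for EVERY extent `ℓ₀` and budget `δ > 0`, a window `T`, a prefactor `B` and `β₂` with clause (i) at every centre and clause
(ii) in UKP form for `TypChainDeep r.ρ θ w ℓ₀ D` at some mesh `1 ≤ b ≤ B e^{Cβ}`, `a β · b < T`, on every mesh-`b` frame. -/
theorem typChainDeepSharpSC_of_clauses_expMesh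
    (h : ∀ (G : Type) [Group G] [TopologicalSpace G] [IsTopologicalGroup G] [CompactSpace G],
      IsCompactSimpleLieGroup G → SimplyConnectedSpace G →
      letI : MeasurableSpace G := borel G; haveI : BorelSpace G := ⟨rfl⟩;
      ∀ (r : LatticeRep G) (a : ℝ → ℝ), (∀ β, 0 < a β) → Tendsto a atTop (𝓝 0) → LowerBounds G r a →
        ∃ (n : ℕ) (ε θ C : ℝ) (D : ℕ), 1 ≤ n ∧ 0 ≤ ε ∧ ε * OnsetFormats.shellCount n ≤ 3 / 4 ∧ 0 < θ ∧
          ∀ (ℓ₀ : ℕ) (δ : ℝ), 0 < δ → ∃ T B β₂ : ℝ, ∀ β : ℝ, β₂ ≤ β → ∃ b : ℕ, 1 ≤ b ∧ a β * (b : ℝ) < T ∧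
            (b : ℝ) ≤ B * Real.exp (C * β) ∧
              ∀ w : Fin 4 → ℤ → ℤ, IsFrame b w →
                ClauseIAll r.ρ β w n ε (TypChainDeep r.ρ θ w ℓ₀ D) ∧ ClauseIIukp r.ρ β w δ (TypChainDeep r.ρ θ w ℓ₀ D)) :
    TypChainDeepSharpSC := by
  intro G _ _ _ _ hG hSC
  letI : MeasurableSpace G := borel G
  haveI : BorelSpace G := ⟨rfl⟩
  intro r a ha ha0 hlb
  obtain ⟨n, ε, θ, C, D, hn, hε, hM, hθ, hrest⟩ := h G hG hSC r a ha ha0 hlb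
  obtain ⟨ℓ₀, hℓ₀⟩ := exists_extent_clauseIII_typChainDeep r hθ C D
  refine ⟨n, ε, θ, ℓ₀, D, hn, hε, hM, fun δ hδ => ?_⟩
  obtain ⟨T, B, β₂, hβ₂⟩ := hrest ℓ₀ δ hδ
  obtain ⟨β₃, hβ₃⟩ := hℓ₀ δ hδ B
  refine ⟨T, max β₂ β₃, fun β hβ => ?_⟩
  obtain ⟨b, hb, habT, hbB, hw⟩ := hβ₂ β (le_trans (le_max_left _ _) hβ)
  exact ⟨b, hb, habT, fun w hfw =>
    ⟨(hw w hfw).1, (hw w hfw).2, hβ₃ β (le_trans (le_max_right _ _) hβ) b hb hbB w hfw⟩⟩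

/-- **REDUCED lane-A supplier statement OF THE DEEP CLASS at the single extent `extentOf θ κ C`** (the deep analogue of the LEAD's
`TypChainReducedAtSC`, p544202): per SC `(G, r, a)` with the floors, `∃ (n, ε, θ, κ, C, D)` admissible, `∀ δ ∃ T B β₂ ∀ β ≥ β₂ ∃ b`, `1 ≤ b`,
`a β · b < T`, `b ≤ B e^{Cβ}`, and on every mesh-`b` frame: clause (i) at every centre for `TypChainDeep r.ρ θ w (extentOf θ κ C) D` AND
`KernelPlaqSparseDeep r.ρ β w θ (extentOf θ κ C) D e^{−κβ}`.  No clause (iii) (inherited torus anchor); clause (ii) in chessboard shape ON THE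
CORE ONLY.  OPEN research content on both conjuncts; not asserted. -/
def TypChainDeepReducedAtSC : Prop :=
  ∀ (G : Type) [Group G] [TopologicalSpace G] [IsTopologicalGroup G] [CompactSpace G],
    IsCompactSimpleLieGroup G → SimplyConnectedSpace G →
    letI : MeasurableSpace G := borel G; haveI : BorelSpace G := ⟨rfl⟩;
    ∀ (r : LatticeRep G) (a : ℝ → ℝ), (∀ β, 0 < a β) → Tendsto a atTop (𝓝 0) → LowerBounds G r a →
      ∃ (n : ℕ) (ε θ κ C : ℝ) (D : ℕ), 1 ≤ n ∧ 0 ≤ ε ∧ ε * OnsetFormats.shellCount n ≤ 3 / 4 ∧ 0 < θ ∧ 0 < κ ∧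
        ∀ δ : ℝ, 0 < δ → ∃ T B β₂ : ℝ, ∀ β : ℝ, β₂ ≤ β →
          ∃ b : ℕ, 1 ≤ b ∧ a β * (b : ℝ) < T ∧ (b : ℝ) ≤ B * Real.exp (C * β) ∧
            ∀ w : Fin 4 → ℤ → ℤ, IsFrame b w →
              ClauseIAll r.ρ β w n ε (TypChainDeep r.ρ θ w (extentOf θ κ C) D) ∧
                KernelPlaqSparseDeep r.ρ β w θ (extentOf θ κ C) D (Real.exp (-(κ * β)))

variable {G : Type} [Group G] [TopologicalSpace G] [IsTopologicalGroup G] [CompactSpace G]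
  [MeasurableSpace G] [BorelSpace G]

/-- **Per-`(G, r)` engine of the deep reduction at the explicit extent `extentOf θ κ C`.**  For every `δ > 0` and `B` there is `β₂'` such
that for `β ≥ β₂'`, every mesh `1 ≤ b ≤ B e^{Cβ}`, every mesh-`b` frame `w` and every depth `D`: deep kernel sparseness at base `e^{−κβ}`
gives clause (ii), and the inherited torus anchor gives clause (iii), both with budget `δ`, for `TypChainDeep r.ρ θ w (extentOf θ κ C) D`
(budget arithmetic = the LEAD's `budget_of_extent`, twice). -/
theorem clauses_typChainDeep_extentOf (r : LatticeRep G) {θ κ : ℝ} (hθ : 0 < θ) (hκ : 0 < κ) (C : ℝ) (D : ℕ) :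
    ∀ δ : ℝ, 0 < δ → ∀ B : ℝ, ∃ β₂' : ℝ, ∀ β : ℝ, β₂' ≤ β →
      ∀ b : ℕ, 1 ≤ b → (b : ℝ) ≤ B * Real.exp (C * β) → ∀ w : Fin 4 → ℤ → ℤ, IsFrame b w →
        (KernelPlaqSparseDeep r.ρ β w θ (extentOf θ κ C) D (Real.exp (-(κ * β))) →
            ClauseIIukp r.ρ β w δ (TypChainDeep r.ρ θ w (extentOf θ κ C) D)) ∧
          ClauseIII r.ρ β w b δ (TypChainDeep r.ρ θ w (extentOf θ κ C) D) := by
  intro δ hδ B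
  obtain ⟨β₁, hIII⟩ := clauseIII_typChainDeep (G := G) r hθ D
  obtain ⟨β₃, h₃⟩ := budget_of_extent (κ := θ / 12) (by positivity) C _
    (two_mul_halfExtent_le_extentOf_left θ κ C) δ hδ B
  obtain ⟨β₄, h₄⟩ := budget_of_extent hκ C _ (two_mul_halfExtent_le_extentOf_right θ κ C) δ hδ B
  refine ⟨max β₁ (max β₃ β₄), fun β hβ b hb1 hbB w hw => ?_⟩
  have hβ1 : β₁ ≤ β := le_trans (le_max_left _ _) hβ
  have hβ3 : β₃ ≤ β := le_trans (le_trans (le_max_left _ _) (le_max_right _ _)) hβ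
  have hβ4 : β₄ ≤ β := le_trans (le_trans (le_max_right _ _) (le_max_right _ _)) hβ
  obtain ⟨hhalf₃, hbud₃⟩ := h₃ β hβ3 b hbB
  obtain ⟨hhalf₄, hbud₄⟩ := h₄ β hβ4 b hbB
  exact ⟨fun hK => clauseIIukp_typChainDeep_of_kernelPlaqSparseDeep r.ρ β hw (Real.exp_pos _).le hhalf₄ hbud₄ hK,
    hIII β hβ1 b _ δ hb1 hhalf₃ hbud₃ w hw⟩

/-- **`TypChainDeepReducedAtSC ⇒ TypChainDeepSharpSC` (PROVED).**  Per SC `(G, r, a)`: the supplier's `(n, ε, θ, D)` and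
`ℓ₀ = extentOf θ κ C`; for each `δ` the later of the two `β₂`'s; (i) is the supplier's, (ii) from its deep kernel sparseness, (iii) inherited. -/
theorem typChainDeepSharpSC_of_reducedAt (h : TypChainDeepReducedAtSC) : TypChainDeepSharpSC := by
  intro G _ _ _ _ hG hsc
  letI : MeasurableSpace G := borel G
  haveI : BorelSpace G := ⟨rfl⟩
  intro r a ha hat hlb
  obtain ⟨n, ε, θ, κ, C, D, hn, hε, hM, hθ, hκ, hsup⟩ := h G hG hsc r a ha hat hlb
  refine ⟨n, ε, θ, extentOf θ κ C, D, hn, hε, hM, fun δ hδ => ?_⟩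
  obtain ⟨T, B, β₂, hβ⟩ := hsup δ hδ
  obtain ⟨β₂', hβ'⟩ := clauses_typChainDeep_extentOf (G := G) r hθ hκ C D δ hδ B
  refine ⟨T, max β₂ β₂', fun β hb => ?_⟩
  obtain ⟨b, hb1, hlt, hbB, hw⟩ := hβ β (le_trans (le_max_left _ _) hb)
  refine ⟨b, hb1, hlt, fun w hwf => ?_⟩
  obtain ⟨hI, hK⟩ := hw w hwf
  obtain ⟨hII, hIII⟩ := hβ' β (le_trans (le_max_right _ _) hb) b hb1 hbB w hwf
  exact ⟨hI, hII hK, hIII⟩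

/-- **`TypChainDeepReducedAtSC ⇒` I♯_SC (PROVED).** -/
theorem onsetSharpUKPcSC_of_typChainDeepReducedAtSC (h : TypChainDeepReducedAtSC) : SharpOnset.OnsetSharpUKPcSC :=
  onsetSharpUKPcSC_of_typChainDeepSharpSC (typChainDeepSharpSC_of_reducedAt h)

/-- **`TypChainDeepReducedAtSC` ∧ residual ⇒ `BalabanLadder.IR` BY NAME (PROVED, E discharged, no X, no torus anchor, boundary layers not
charged).** -/
theorem ir_of_typChainDeepReducedAtSC (h : TypChainDeepReducedAtSC) (hN : SharpOnset.IRNSC) :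
    Summit.QuantumFields.YangMills.Theses.BalabanLadder.IR :=
  ir_of_typChainDeepSharpSC (typChainDeepSharpSC_of_reducedAt h) hN

end Supplier

end Summit.QuantumFields.YangMills.Cruxes.IR.AfPincerUc.SharpLanes

end
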